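import Mathlib
import HarnessLib
import HarnessLib.Audit
import Summits.AtomisticToContinuum.Statement

/-!
Route: LoadedDice

CLOSED (retired) 2026-08-15T13:44:16Z by operator:999:1257524 — reason: not-a-thesis: assembly does not conclude the sub-problem Statement — note: D-0027 §2.1 audit (human 2026-08-15: routes that do not decide the summit are removed): the assembly concludes `Literature.MathematicalPhysics.KineticTheory.HydrodynamicLimit`, not the sub-problem statement; a NEW conforming route may be opened from the same idea (generated `closes : … → _root_.Hydr. The file is kept as the record of this route; refuted decls are indexed as negative knowledge (`ledger negatives`).

# Route LoadedDice — Loaded dice — Jeans' eccentric spheres read an integrable clock at each contact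
— an Euler rung with the exact hard-sphere law for a Hamiltonian gas, and a one-kick-footprint
transfer to the conjunct

X = X_R ∧ X_T ("it suffices to show"), realising card loaded-dice-jeans-spheres (spine and only
card). THE FAMILY LS(σ, ξ, ι): N+1 of Jeans' LOADED SPHERES on 𝕋³ — perfectly smooth hard spheres of
diameter ε_N = σ(N+1)^(-1/3) (the conjunct's own scaling: fixed reduced density) and unit mass whose
mass centre sits ξε_N off the geometric centre along a body vector a ∈ S², with isotropic inertia
ιε_N² about the mass centre; deterministic dynamics = free flight of the mass centre and uniform
rotation of a about the angular momentum L between contacts, and at a contact of geometric centres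
the frictionless elastic rigid-body impact of support LoadedImpactInvolution (impulse J·n along the
contact normal, J = 2g_n/(2 + (ξ²/ι)Σ_k(1 − ⟨a_k,n⟩²)), g_n the normal velocity of the material
contact points); data = loaded local Gibbs (geometric centres hs-local-Gibbs with activity a₀,
Maxwellian(u₀,θ₀) velocities, Haar orientations, Gaussian angular momenta). ξ = 0 IS the conjunct's
gas (⊗ an invisible free rotation); EVERY member has exactly the hard-sphere statics (contact iff
geometric centres at distance ε_N: hsFreeVolume, hsPressure unchanged) and conserves mass, momentum
and energy; L·a is conserved per particle (passive label), so two rotational degrees of freedom are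
active.
X_R (LOADED RUNG; informal cruxes PhaseFreshness rank 2 and LoadedEulerRung rank 4, typed when
definition requests D1–D2 land): for every FIXED ξ ∈ (0,1/2), ι > 0 and all continuous profiles
there is σ₀ such that for σ < σ₀ the empirical density / momentum / translational-kinetic-energy
fields of LS(σ,ξ,ι) converge in probability, up to the first shock, to the classical solution of the
LOADED Euler system (p = hsPressure σ ρ θ, E = ρ(|u|²/2 + 5θ/2)) — a compressible-Euler theorem for
a deterministic, reversible, momentum-conserving Hamiltonian gas at fixed positive density with the
conjunct's equation of state. Its engine is the card's self-sustaining dice: the load phase a read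
at each contact is, conditionally on the coarse past, Haar up to η ≈ C√ι·φ/ξ (φ = ρσ³), because
between contacts it turns Θ ≈ 0.225/(φ√ι) ≫ 2π radians and each impact changes the clock RATE
|L|/(ιε²) by a relative O(ξ/√ι) — a top kicked at random times by random partners at stochasticity Λ
≈ 0.225ξ/(φι) ≫ 1 (Fejér wrapping, support FejerWrapping).
X_T (TRANSFER; typed skeleton): OneKickFootprint (rank 3: the Euler-scale linear response of the
TRUE hard-sphere gas to one local momentum- and energy-conserving kick is hydrodynamic, O(ε_N/N) on
smooth fields) ∧ ContactIntensityDomination (rank 6, shared with route AprioriTailsRattlers) ⇒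
HydrodynamicLimit through the consumer LoadedTransfer, whose intended proof is the loaded programme
run along ξ_N = κ(N+1)^(-1/6) (informal crux TwoTemperatureRung, rank 5, conjunct-hard and labelled
so) plus a Lindeberg swap in ξ: the ≍(N+1)^(4/3) collisions contribute ξ_N × (footprint
(N+1)^(-4/3)) each, O(ξ_N) in total at first order and ξ_N²(N+1)^(1/3) = κ² at second order
(translation–rotation energy exchange), then κ → 0.
Lean: `OneKickFootprint ∧ ContactIntensityDomination ∧ LoadedTransfer`

## Assembly
Pure logic (modus ponens; proved sorry-free as `assembly_holds` in the folder's Sketch.lean, axioms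
propext / Classical.choice / Quot.sound): OneKickFootprint and ContactIntensityDomination are fed to
the consumer LoadedTransfer, whose conclusion is the conjunct
`Literature.MathematicalPhysics.KineticTheory.HydrodynamicLimit` (= the sub-problem statement
`HydrodynamicLimit`, an abbrev). The CONTENT sits upstream and is informal until D1–D2 land:
PhaseFreshness → LoadedEulerRung (the analogue rung X_R at fixed ξ, a parallel chain that is NOT a
hypothesis of the conjunct's assembly — it is where the dice engine is first provable and
MD-falsifiable) and TwoTemperatureRung + TwoTemperaturePDE + the Lindeberg swap ⇒ LoadedTransfer.
Stated plainly: nothing below LoadedTransfer implies the conjunct without TwoTemperatureRung, which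
is conjunct-hard.

Rationale: WHY THIS LINE. Jeans' loaded sphere (ChapmanCowling1970 §11.1 p. 200 and note (27): "a smooth
elastic sphere whose mass-centre does not coincide with its geometrical centre"; Jeans 1901/1904
studied exactly the equipartition of translatory and rotatory energy for slightly eccentric spheres;
kinetic/Enskog theory with chaos ASSUMED: Dahler–Sather doi:10.1063/1.1733511, Sandler–Dahler
doi:10.1063/1.1697003, doi:10.1063/1.1841253) is the minimal PHYSICAL Hamiltonian deformation of the
conjunct's system in which each collision consults a fast INTEGRABLE internal clock, and the card's
point is that the clock needs no chaos: fast-phase averaging (Arnold1989 §52; Kifer2009,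
Dolgopyat2005 for averaging with feedback) read at random contact times gives Weyl/Fejér
equidistribution of impact outcomes with an EXPLICIT, N-INDEPENDENT defect C√ι·φ/ξ, regenerated
flight after flight because the impact re-randomises the clock rate (random compositions of strongly
kicked twist maps: Blumenthal–Xue–Young doi:10.4007/annals.2017.185.1.5,
doi:10.1007/s00220-017-2999-2) — so the angular half of the Stosszahlansatz becomes a one-line
mechanism on a gas with exactly the conjunct's equation of state, and the stochastic-rung ergodic
theorems (OllaVaradhanYau1993, FritzFunakiLebowitz1994, LiveraniOlla1996, Rezakhanlou2003) are asked
only of the phase-AVERAGED kernel. Imported areas: rigid-body impact mechanics (CoxFeres2016),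
averaging / random dynamical systems (kicked tops), Yau's relative-entropy method, hyperbolic
relaxation (ChenLevermoreLiu1994, doi:10.1006/jdeq.1998.3584, Tzavaras2005) for the two-temperature
family ξ_N = κ(N+1)^(-1/6) interpolating to the conjunct. What it does that the board does not:
AnosovRotorDice needs an ANOSOV rotor and a designed die, VanishingNoise / SpecularLambertianSwap
impose stochastic rules, SoftShoulderLandauDial changes the equation of state along its dial — here
the randomiser is integrable, the impact law physical, the statics the conjunct's at every ξ; and
the transfer analysis isolates a NEW typed true-gas statement, OneKickFootprint (hydrodynamic size
of the mean response to one conservative kick), which is the load-bearing true-gas input of every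
kick-by-kick comparison on the board (VanishingNoise (ii) stmt-0812, SpecularLambertianSwap.SwapGap,
this route's LoadedTransfer) and fails for the ideal gas, as a genuine input must.

RANKED CRUXES. Five ranked cruxes; three need vocabulary Lean lacks (the loaded flow D1, the loaded
/ two-temperature Euler systems D2) and are filed right after open with `ledger workitem add
--informal` (full wording there), typed by set-signature when D1–D2 land:
Rank 2, PhaseFreshness (informal) — CONDITIONAL PHASE FRESHNESS (card E3 as a theorem): in
LS(σ,ξ,ι), ξ ∈ (0,1/2) and ι > 0 fixed, loaded local Gibbs data, σ < σ₀(profiles,ξ,ι), uniformly in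
N and t ≤ T: at every contact (i,j), conditionally on the r-coarse past of ALL particles (ε ≪ r ≪ ℓ)
and on all data of the others, the law of the load phases (a_i,a_j) is within η = C(ι)φ/ξ of
Haar⊗Haar in total variation, off an exceptional class of contacts (re-contact with the previous
partner; flights < ε√ι/ξ; near-grazing or a ∥ n) of conditional frequency ≤ C′φ/ξ. Engine:
FejerWrapping + the rate kick (relative O(ξ/√ι), smooth 2-D dependence on a) over flights of Θ ≍
0.225/(φ√ι) rad — the phase map a ↦ a_next expands by Λ ≍ 0.225ξ/(φι) ≫ 1 per contact, a top kicked
at random times by Gibbs-placed partners; induction along collision sequences from the Haar base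
case. Why it might fail: the flight/partner randomness is conditional on a coarse past that also
constrains partners — in transient dense clusters (rattler cages) and ring re-contacts the
next-contact geometry is correlated with the phase just read; their frequency must be O(φ) uniformly
in N along the NON-equilibrium evolution (the ring sector every fixed-density card meets). Sources:
doi:10.1063/1.1733511, ChapmanCowling1970, Arnold1989, doi:10.4007/annals.2017.185.1.5, Kifer2009,
Dolgopyat2005.
Rank 4, LoadedEulerRung (informal) — X_R as in § Thesis, in the conjunct's format (∀ξ∀ι∀profiles ∃σ₀
∀σ<σ₀ ∀ classical loaded-Euler solutions on [0,T) ∀ loaded flows: convergence of the three fields at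
t = 0 ⇒ at every t < T). Intended proof (layer 2): (i) PhaseAveragedGibbsianity — regular
translation-invariant stationary states of the infinite-volume dynamics randomised by the
phase-AVERAGED kernel K̄_ξ (phases redrawn from Haar at each contact; conservative and
Maxwellian⊗Gaussian-reversible by LoadedImpactInvolution) are Gibbs⊗Haar⊗Gaussian mixtures
(Liverani–Olla / FFL Dirichlet-form step + hard-core configurational step); (ii)
LoadedEntropyGronwall — Yau's Gronwall for H(f_t|ψ_t^load)/(N+1) with one-block input PhaseFreshness
+ (i) at precision ω(η), two-block / LD from the UNCHANGED hard-sphere statics (LoadedStatics), tail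
control of the |V|³ and |V||L|² currents; gives the δ(η)-accurate form (card rung A), the exact form
needing the shared ring-sector input (rung B). Why it might fail: N-uniform coercivity of the K̄_ξ
Dirichlet form per collision with UNBOUNDED velocities (Kac/Villani/Carlen–Carvalho constants) and
the cubic energy-current tails along the loaded flow (HighMomentumCutoffBarrierNarrow verbatim).
Sources: OllaVaradhanYau1993, LiveraniOlla1996, FritzFunakiLebowitz1994, Rezakhanlou2003, Yau1991,
CarlenCarvalhoGabetta2000, NachtergaeleYau2003.
Rank 5, TwoTemperatureRung (informal) — along ξ_N = κ(N+1)^(-1/6), κ ∈ (0,κ₀], the same conclusion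
with the TWO-TEMPERATURE loaded Euler system as target (D2: p = hsPressure σ ρ θ_tr; translational
energy with source −κ²cρ(θ_tr − θ_rot), active rotational energy ρθ_rot advected with source
+κ²cρ(θ_tr − θ_rot), c = Dahler–Sather's exchange rate), UNIFORMLY in κ — what LoadedTransfer
consumes (κ → 0 returns the conjunct's system, support TwoTemperaturePDE). Why it might fail:
CONJUNCT-HARD and said so — as ξ_N → 0 the dice defect φ/ξ_N → ∞, phase-random exchanges number only
κ² per particle per unit time where OVY-type inputs need ≫ 1: VanishingNoise's interchange
(stmt-AtomisticToContinuum-0812) in Hamiltonian clothing, made the LAST step, not an easier one.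
Sources: OllaVaradhanYau1993, ChenLevermoreLiu1994, doi:10.1006/jdeq.1998.3584,
doi:10.1103/physreve.96.042143, doi:10.1063/1.1697003, Spohn1991.
Typed items follow; OneKickFootprint and ContactIntensityDomination precede LoadedTransfer so the
gate elaborates them in order.
#3 OneKickFootprint (crux) — ONE-KICK FOOTPRINT (Euler-scale linear response of the TRUE hard-sphere
gas to a local conservative kick is hydrodynamic). Conjunct's frame (profiles; σ < σ₀; classical
hs-Euler solution on [0,T); flows; local Gibbs data converging at t = 0); for every T′ < T and
Lipschitz χ there are C, N₀ such that for N ≥ N₀, |α| ≤ 1, t ∈ [0,T′]: kicking the INITIAL datum by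
rotating the relative velocity of particles 0 and 1 by the angle α towards their separation vector
(centre-of-mass velocity and relative speed kept: mass, momentum, kinetic energy exactly conserved)
WHENEVER they are within 2ε_N (probability ≍ σ³/(N+1)) changes the EXPECTED empirical density,
momentum and energy fields at time t tested against χ by at most C|α|(N+1)^(-7/3) — i.e.
O(|α|ε_N/(N+1)) per delivered kick: a dipole of conserved quantities with arm ≤ 2ε_N (then ≍ a mean
free path ≍ N^(-1/3)) propagated by linearised hydrodynamics acting on the smooth test function,
instead of O(|α|/(N+1)) for two freely streaming particles (ideal gas) or the fluctuation level
(N+1)^(-3/2) (trivial bound). [difficulty: open-problem] (why it might fail: The MEAN response of a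
chaotic deterministic gas must stay at the conserved-dipole size ε/N for macroscopic times; a kick
that biases the pair's LATER collisions (ring re-collisions, weight O(ρσ³)) or a slow
non-hydrodynamic mode gives C/N instead; false for the ideal gas.) [OllaVaradhanYau1993, Spohn1991,
BodineauGallagherSaintRaymondSimonella2023, doi:10.4007/annals.2023.198.3.3, LiveraniOlla1996]
#6 ContactIntensityDomination (crux) — Shared verbatim with route AprioriTailsRattlers (its crux
(R), stmt-AtomisticToContinuum-4604): along the deterministic flow from local Gibbs data at σ < σ₀,
the time-integrated expected INCOMING CONTACT INTENSITY of any continuous φ ≥ 0 of the two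
pre-collisional velocities over [s,t] is ≤ C·σ²(N+1)^(1/3)/(N+1) × ∫_s^t ∫∫ φ(v,w)|v−w| under the
product of the time-τ one-particle laws (no more collisions, weighted any way, than C ×
Boltzmann–Enskog). Here: the size control of LoadedTransfer's Lindeberg sum (φ = |v−w|, |v−w|²: kick
budget Σ_contacts ξ_N|g| ≍ ξ_N(N+1)^(4/3)) and of PhaseFreshness' exceptional classes. [difficulty:
open-problem] (why it might fail: Transient dense clusters (rattlers) along the non-equilibrium
evolution could make the collision intensity history-dependent and exceed any Enskog-type product
bound at fixed σ; nothing beyond equilibrium is known at positive density.) [GST2013, Spohn1991,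
BodineauGallagherSaintRaymondSimonella2023, Alexander1975]
#9 EquilibriumKickResponse (support) — GLOBAL-EQUILIBRIUM special case of OneKickFootprint (profiles
a₀ ≡ 1, u₀ ≡ 0, θ₀ ≡ θe; any horizon T; same kick, fields and bound C|α|(N+1)^(-7/3)): a
Green–Kubo-type statement — mean field response at time t to a conserved dipole planted at time 0
under the invariant Gibbs law — the cheapest place to prove or refute the footprint (equilibrium
time-correlation technology). [deps: OneKickFootprint] [difficulty: XL] [Spohn1991,
BodineauGallagherSaintRaymondSimonella2023, doi:10.4007/annals.2023.198.3.3]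
#9 FejerWrapping (support) — FEJÉR WRAPPING (card E3a, provable now): if a real random variable τ
has a probability density f with L¹-modulus ∫|f(x+h) − f(x)|dx ≤ L|h|, then for every frequency Ω >
0 and phase θ₀ the law of θ₀ + Ωτ mod 1 is within L/(4Ω) of Haar on the circle, set by set: |P(θ₀ +
Ωτ ∈ A) − |A|| ≤ L/(4Ω) for every measurable A ⊂ ℝ/ℤ (average the wrapped density over one period).
With f = s⁻¹F(·/s) this is the card's C/(Ωs). [difficulty: provable-now] [Arnold1989, Kifer2009]
#9 LoadedImpactInvolution (support) — FAIR-DICE MECHANICS (card S1, provable now; fixes the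
collision law of D1): for diameter ε > 0, eccentricity ξ ≥ 0, isotropic inertia ιε², unit masses,
unit vectors a_i, a_j (mass centre → geometric centre) and contact normal n (i → j), the two-body
impact map Λ on (V_i,V_j,L_i,L_j) — g_n = ⟨n,V_i − V_j⟩ + ξε(⟨n,ω_i×a_i⟩ − ⟨n,ω_j×a_j⟩), ω =
L/(ιε²); J = 2g_n/(2 + (ξ²/ι)((1 − ⟨a_i,n⟩²) + (1 − ⟨a_j,n⟩²))); V_i ↦ V_i − Jn, V_j ↦ V_j + Jn, L_i
↦ L_i − Jξε(a_i×n), L_j ↦ L_j + Jξε(a_j×n) — conserves V_i + V_j and |V_i|²/2 + |V_j|²/2 + (|L_i|² +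
|L_j|²)/(2ιε²), reverses g_n, and is an involution (being linear, it then preserves Lebesgue
measure: Liouville⊗Gaussian invariance and detailed balance of K̄_ξ follow by Haar-averaging).
[difficulty: provable-now] [doi:10.1063/1.1733511, ChapmanCowling1970, CoxFeres2016]
#9 LoadedTransfer (support) — THE CONSUMER (typed shadow of the card's leg (C)): OneKickFootprint →
ContactIntensityDomination → HydrodynamicLimit. Intended proof = the loaded programme:
TwoTemperatureRung puts the translational fields of LS(σ, κ(N+1)^(-1/6), ι) within o_N(1) of the
two-temperature solution, TwoTemperaturePDE puts that within O(κ²) of the conjunct's Euler solution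
on [0,T′], and a Lindeberg/Duhamel swap in ξ ∈ [0, κ(N+1)^(-1/6)] (d/dξ E_ξ[F(fields_t)] =
Σ_contacts E[(∂_ξ outcome)·(footprint)], footprint bound assumed UNIFORM along the loaded family,
contact budget from ContactIntensityDomination) puts the true gas's field laws within
O(κ(N+1)^(-1/6)) + O(κ²) of the loaded ones; κ → 0 last. In substance as hard as the conjunct
(contains TwoTemperatureRung); filed so that the Assembly is pure logic and the two typed true-gas
inputs are refutable now. [deps: OneKickFootprint, ContactIntensityDomination] [difficulty:
open-problem] [OllaVaradhanYau1993, ChenLevermoreLiu1994, Spohn1991]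

TWO-LAYER PLAN. Foreseen glued splits (k ≤ 3, depth 1), none filed now. PhaseFreshness ⇐
KickedTopExpansion (finite-dimensional: off {a ∥ n} ∪ {grazing} the map a_now ↦ a_next through one
impact and one flight of length ℓ′ expands area on S² by ≥ cξℓ′/(ει), with distortion bounds —
calculus on LoadedImpactInvolution) → FreshPartnerGeometry (given the coarse past, the next
partner's relative position has a density at scale ≫ ε off the ring/short-flight classes, of
conditional frequency ≤ C′φ/ξ uniformly in N) → PhaseFreshness (induction, FejerWrapping at each
step). LoadedEulerRung ⇐ PhaseAveragedGibbsianity → LoadedEntropyGronwall → LoadedEulerRung.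
OneKickFootprint ⇐ EquilibriumKickResponse (filed) → KineticToHydroRelaxation (the kicked pair's
perturbation relaxes in mean onto the five conserved fields within O(1) mean free times) →
OneKickFootprint (linearised hs-Euler on the test function, pre-shock). TwoTemperatureRung is not
split before LoadedEulerRung moves.

KILL CRITERIA. (1) ¬PhaseFreshness in its cheapest form — MD of LS at φ ∈ {0.01, 0.05}, ξ ∈ {0.2,
0.4}, ι = 0.1 showing a TV-distance-to-Haar of contact phases (conditioned on binned coarse pasts)
that does NOT scale like φ/ξ, or drifts with N — kills the dice engine: close
`refuted:PhaseFreshness` (X_R dies; OneKickFootprint survives as a statement wanted by the swap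
routes). (2) ¬OneKickFootprint (mean response ≍ (N+1)^(-2), i.e. 1/N per delivered kick — e.g. from
ring re-collisions at positive ρσ³ — or already ¬EquilibriumKickResponse) kills LoadedTransfer AND
every kick-by-kick comparison on the board (VanishingNoise (ii), SpecularLambertianSwap.SwapGap in
Lindeberg form): close `refuted:OneKickFootprint`, hand the witness over as negative knowledge; X_R
survives only as an analogue theorem (re-file it Literature-side and retire the route here). (3)
¬ContactIntensityDomination closes AprioriTailsRattlers' consumer and this transfer alike (shared
kill). (4) ¬LoadedImpactInvolution (an algebra slip) forces a restate of D1's collision map, not a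
close. Mooted: HydrodynamicLimit proved elsewhere moots LoadedTransfer/Assembly only. Superseded:
VanishingNoise's StochasticStability (0812) proved with a budget covering κ² exchanges per particle
per unit time gives TwoTemperatureRung from LoadedEulerRung-type inputs — re-rank, do not close.

NOT DECOMPOSED YET. Everything loaded beyond the three informal cruxes: the infinite-volume objects
for PhaseAveragedGibbsianity (marked regular stationary states, D3 of route AnosovRotorDice with
marks (a,L); not re-filed), the loaded tail input (|V|³, |V||L|² currents), the ring-sector
frequency bound inside PhaseFreshness, the grazing / a ∥ n degeneracy sets, C(ι) and the
ι-dependence (ι → 0: fast light clock, large kicks; ι large: slow clock), triaxial loads (Euler-top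
clock, e = 3θ — same mechanism, not filed), the phase-averaged kernel gas K̄_ξ as a stochastic rung
of its own (angular-noise-ladder's territory), the uniform-in-ξ footprint along the loaded family
(needs D1), kick-at-time-s versions of OneKickFootprint, rates in TwoTemperaturePDE, and the
negative side (¬TwoTemperatureRung would be evidence about the conjunct itself; not filed before X_R
moves). LoadedStatics and TwoTemperaturePDE are filed as informal supports right after open.

CHEAPEST FALSIFIER. Pen and paper first (an hour): (i) kicked-top bookkeeping — with ⟨|L|²⟩ = 3ιε²θ,
|ω| = |L|/(ιε²), flight time ℓ/ḡ, check Θ ≈ 0.225/(φ√ι) and that ΔL = Jξε|a×n| changes |L| by a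
RELATIVE O(ξ/√ι) with non-degenerate 2-D dependence on a (if the rate kick were O(ξ²) or
one-dimensional, Λ ≲ 1 at φ = 0.05 and PhaseFreshness loses its engine); (ii) footprint arithmetic —
instantaneous conditional response |α|·E|g|·Kε_N/(N+1) and the free-streaming counterexample (ideal
gas: |α|(χ(x₁+v₁t) − χ(x₀+v₀t))/(N+1) = O(|α|/N) once t ≫ ε/|g|), confirming OneKickFootprint is
false at σ = 0 and so says something. Then ONE kit job (not run: planner seat): event-driven MD, N =
10⁴–10⁵ loaded spheres, ι = 0.1, ξ ∈ {0, 0.2, 0.4}, φ ∈ {0.01, 0.05}: (a) contact-phase histograms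
(⟨a_i,n⟩, ⟨a_i,ĝ⟩) conditioned on binned coarse pasts — TV to Haar must scale like φ/ξ,
N-independently; (b) at equilibrium plant conserved dipoles (α = 0.3) on all pairs closer than 2ε at
t = 0 and measure the mean momentum-field response at t = 0.2, 0.5, 1 against χ = sin(2πx₁): ε/N per
kick, not 1/N (EquilibriumKickResponse); (c) θ_rot/θ_tr relaxation after ≍ ξ⁻² contacts per
particle.

NUMBERS. Scaling: ε_N = σ(N+1)^(-1/3), (N+1)ε_N³ = σ³, φ = ρσ³; ≍(N+1)^(1/3) contacts per particle
per unit time, ≍(N+1)^(4/3) in total. Mean free path ℓ/ε = 1/(√2πφ) = 4.50 (φ = 0.05), 22.5 (φ =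
0.01). Clock: ⟨|L|²⟩ = 3ιε²θ, |ω| ≈ √(3θ/ι)/ε, turn per flight Θ ≈ 0.225/(φ√ι) = 14.2 rad (φ = 0.05,
ι = 0.1), 71 rad (φ = 0.01). Kick: J ≈ g_n(1 + O(ξ²/ι)), |ΔL|/|L| ≈ ξ/√(3ι) = 0.55 (ξ = 0.3, ι =
0.1); expansion per contact Λ ≈ 0.225ξ/(φι) = 13.5 (φ = 0.05), 67 (φ = 0.01); dice defect η ≈
√2π·√ι·φ/ξ = 0.23 (φ = 0.05, ξ = 0.3, ι = 0.1), 0.047 (φ = 0.01); exceptional contacts O(φ/ξ) +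
O(φ). Rot–trans energy exchange O(ξ) per contact, random sign ⇒ equilibration after ≍ ξ⁻² contacts =
ξ⁻²(N+1)^(-1/3) macroscopic time; ξ_N = κ(N+1)^(-1/6) ⇒ O(1) rate κ²c. Loaded Euler: E = ρ(|u|²/2 +
5θ/2), ideal-part exponent 7/5 < 5/3 (sub-characteristic ordering). Transfer: first-order Lindeberg
sum ≍ ξ_N; second order ξ_N²(N+1)^(1/3) = κ². Footprint: P(particles 0,1 within 2ε_N) ≈
(28π/3)σ³·(contact value)·∫ρ₀²/(N+1); instantaneous conditional momentum response ≤
|α|·E|g|·K·ε_N/(N+1); claimed uniform bound C|α|(N+1)^(-7/3); fluctuation level (N+1)^(-3/2);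
ideal-gas value ≍ |α|(N+1)^(-2). Items: 7 typed at open (2 cruxes, 4 supports, assembly) + 5
informal right after (3 cruxes, 2 supports) = 12 ≤ 15.

DEFINITION REQUESTS. (D1) `LoadedSphereFlow` (+ `LoadedConfig`, `loadedLiouville`,
`loadedLocalGibbsLaw`; topic Literature/Analysis/FluidPDE next to HardSphereDynamics): LoadedConfig
N := Fin N → (T3 × V3) × (V3 × V3) = ((geometric centre X, mass-centre velocity V), (load vector a,
angular momentum L)); domain |a_k| = 1, pairwise torus distance of the X_k ≥ ε; free motion:
straight flight of C_k = X_k − ξεa_k with velocity V_k, a_k rotated about L_k by t|L_k|/(ιε²);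
contact of (i,j) iff euclidDist X_i X_j = ε, incoming iff g_n > 0, post-contact map EXACTLY as in
support LoadedImpactInvolution (n = unit minimal-image vector from X_i to X_j);
`IsLoadedSphereTrajectory` / `LoadedSphereFlow G ε ξ ι N` mirroring IsHardSphereTrajectory /
HardSphereFlow (good set, group property, measurability, trajectories, preservation of
loadedLiouville := volume⊗volume⊗(surface measure on S²)⊗volume per particle); the CONSTRUCTION
"non-empty on the torus for ε < 1/2" (Alexander's scheme; a.e. no grazing / triple contact /
chattering accumulation) is a SEPARATE statement, never a field; loadedLocalGibbsLaw: density ∝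
𝟙_domain ∏ a₀(X_k) M_(1,u₀(X_k),θ₀(X_k))(V_k)·Gaussian(L_k; variance ιε²θ₀(X_k)), Haar in a_k;
empirical fields = the library's three fields of k ↦ (X_k,V_k); ξ = 0 reduces to HardSphereFlow ⊗
free rotation. Needed by PhaseFreshness, LoadedEulerRung, TwoTemperatureRung, LoadedStatics.
(D2) `IsLoadedEulerSolution σ T ρ u θ` = IsHardSphereEulerSolution with totalEnergyDensity replaced
by ρ(‖u‖²/2 + 5θ/2), and `IsTwoTemperatureEulerSolution σ κ c T ρ u θtr θrot` = its mass/momentum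
equations with θtr in hsPressure, translational energy ρ(‖u‖²/2 + 3θtr/2) with flux (E_tr + p)u and
source −κ²c(ρ,θtr,θrot)ρ(θtr − θrot), plus ∂ₜ(ρθrot) + div(ρθrot u) = +κ²cρ(θtr − θrot), c > 0
smooth (topic Literature/MathematicalPhysics/KineticTheory; typable now over TorusCalculus — support
TwoTemperaturePDE inlines them if they have not landed).
(D3) not filed: marked `RegularStationaryState` — AnosovRotorDice's request covers it once marks
(a,L) are allowed. Cite facts (when a typed consumer exists): Dahler–Sather's exchange rate
(doi:10.1063/1.1733511), Yong's relaxation limit (doi:10.1006/jdeq.1998.3584).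

Novelty: Searches (2026-08-15; searchd rc 75 twice and OpenAlex/arXiv HTTP 429 during the session, logged in
NOTES.md): `lit frontier AtomisticToContinuum --since 2020` (30 rows: the only deterministic
hydrodynamic-type limit is arXiv:2310.13338, diffusive; nothing with rotational degrees of freedom);
`lit bridges AtomisticToContinuum --cross any` (30 rows, none relevant); `lit search --source
crossref "Dahler Sather kinetic theory of loaded spheres"` (10: doi:10.1063/1.1733511,
doi:10.1063/1.1697003, doi:10.1063/1.1841253, doi:10.1063/1.1712279 — loaded spheres I–IV,
Boltzmann/Enskog level, chaos assumed); `lit search "Blumenthal Xue Young Lyapunov exponents random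
perturbations standard map"` (local 10 + remote 12: doi:10.4007/annals.2017.185.1.5,
doi:10.1007/s00220-017-2999-2, arXiv:2004.10626); `lit search --source crossref "hydrodynamic limit
hard spheres with rotation rough spheres rigorous Euler"` (12, none rigorous: granular/ET moment
closures only, e.g. doi:10.1103/physreve.81.066307); `lit search --source crossref "Yong singular
perturbations hyperbolic stiff source"` (doi:10.1006/jdeq.1998.3584); `lit search --source crossref
"polyatomic gas two temperatures hyperbolic relaxation Ruggeri"` (doi:10.1103/physreve.96.042143,
the ET6 two-temperature system); `lit galaxy search "loaded sphere(s)" --star all` (20 rows, all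
noise); held books read: book:chapman1970-mathematical-theory-non-uniform-gases-account-kinetic p.
200 (§11.1, the eccentric smooth sphere as "the next simples  [refs: 10.1063/1.1733511, 10.1063/1.1697003, 10.1063/1.1841253, 10.1063/1.1712279, 10.4007/annals.2017.185.1.5, 10.1007/s00220-017-2999-2, 10.1103/physreve.81.066307, 10.1006/jdeq.1998.3584, 10.1103/physreve.96.042143, 2310.13338, 2004.10626, doi:10.1063/1.1733511, doi:10.1063/1.1697003, doi:10.1063/1.1841253, doi:10.1063/1.1712279, doi:10.4007/annals.2017.185.1.5, doi:10.1007/s00220-017-2999-2, doi:10.1]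

Barriers (technique_class: fast-phase-averaging, lindeberg-swap, relative-entropy): - technique_class: fast-phase-averaging, lindeberg-swap, relative-entropy
- Literature.Barriers.AtomisticToContinuum.BoltzmannHypothesisBarrier: for the LOADED gas the
angular half of molecular chaos is DERIVED (PhaseFreshness) and a classification of stationary
states is asked only of the phase-AVERAGED stochastic kernel K̄_ξ (Liverani–Olla/FFL type, evasion
(i) with the noise manufactured by the Hamiltonian clock); the barrier's formal kernel is respected
twice: with no collisions the clock is never read (ideal gas: nothing claimed), and OneKickFootprint
is FALSE for free flight (footprint 1/N, not ε/N). For the conjunct proper the barrier is not evaded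
but relocated, honestly, into TwoTemperatureRung.
- Literature.Barriers.AtomisticToContinuum.BoltzmannHypothesisBarrierNarrow: the flux-level closure
is obtained for LS via PhaseFreshness + PhaseAveragedGibbsianity, not assumed; for the true gas the
route consumes no closure at all — its typed true-gas inputs are a linear-response bound
(OneKickFootprint) and a collision-intensity bound, both outside the narrowed technique class; the
closure difficulty re-enters only through TwoTemperatureRung (stated).
- Literature.Barriers.AtomisticToContinuum.MacroErgodicityBarrier: no sector condition /
fluctuation–dissipation step is used (Euler scaling); macro-ergodicity is replaced, for LS, by
conditional phase freshness with an explicit defect; for the conjunct see the previous two lines.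
- Literature.Barriers.AtomisticToContinuum.Hi

History (route lifecycle, newest last):
- 2026-08-15T13:44:16Z · CLOSED retired — not-a-thesis: assembly does not conclude the sub-problem Statement (operator:999:1257524)

sub-problem: HydrodynamicLimit · status: closed(retired) · opened planner-plancard-AtomisticToContinuum-Hydrody-f6396ded-0 2026-08-15T12:14:21Z · rev 0 · ledger route-AtomisticToContinuum-LoadedDice
GENERATED by the gate from the ledger (D-0016/17). Provers cite these decls: `theorem foo : Summit.AtomisticToContinuum.HydrodynamicLimit.Theses.LoadedDice.<Decl> := …` in Summits/AtomisticToContinuum/HydrodynamicLimit/Theorems/<Name>.lean.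
-/

namespace Summit.AtomisticToContinuum.HydrodynamicLimit.Theses.LoadedDice

open scoped BigOperators Topology Manifold Classical MeasureTheory ProbabilityTheory Matrix InnerProductSpace ComplexConjugate ContinuousMap
open Filter Set Function TopologicalSpace MeasureTheory

attribute [summit_statement] _root_.HydrodynamicLimit

-- item stmt-AtomisticToContinuum-7822 · crux · rank 2 · closed · moot by None · by planner — informal only, no Lean statement yet:
--   [crux] CONDITIONAL PHASE FRESHNESS (card loaded-dice-jeans-spheres, E3 as a theorem; the dice
--   engine). System LS(σ,ξ,ι) of definition request D1 (N+1 Jeans loaded spheres on 𝕋³: smooth hard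
--   spheres of diameter ε_N = hsDiameter σ N, unit mass, mass centre ξε_N off the geometric centre along
--   a ∈ S², isotropic inertia ιε_N², free flight + uniform rotation of a about L between contacts,
--   impact map of support LoadedImpactInvolution), fixed ξ ∈ (0,1/2) and ι > 0, loaded local Gibbs data
--   (loadedLocalGibbsLaw σ ξ ι a₀ u₀ θ₀), σ < σ₀(profiles, ξ, ι). CLAIM, uniformly in N and in
--   macroscopic t ≤ T (pre-

/-- item stmt-AtomisticToContinuum-7658 · crux · rank 3 · closed · moot by None · by planner
why it might fail: The MEAN response of a chaotic deterministic gas must stay at the conserved-dipole size ε/N for macroscopic times; a kick that biases the pair's LATER collisions (ring re-collisions, weight O(ρσ³)) or a slow non-hydrodynamic mode gives C/N instead; false for the ideal gas.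
sources: OllaVaradhanYau1993, Spohn1991, BodineauGallagherSaintRaymondSimonella2023, doi:10.4007/annals.2023.198.3.3, LiveraniOlla1996
[crux] ONE-KICK FOOTPRINT (Euler-scale linear response of the TRUE hard-sphere gas to a local
conservative kick is hydrodynamic). Conjunct's frame (profiles; σ < σ₀; classical hs-Euler solution
on [0,T); flows; local Gibbs data converging at t = 0); for every T′ < T and Lipschitz χ there are
C, N₀ such that for N ≥ N₀, |α| ≤ 1, t ∈ [0,T′]: kicking the INITIAL datum by rotating the relative
velocity of particles 0 and 1 by the angle α towards their separation vector (centre-of-mass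
velocity and relative speed kept: mass, momentum, kinetic energy exactly conserved) WHENEVER they
are within 2ε_N (probability ≍ σ³/(N+1)) changes the EXPECTED empirical density, momentum and energy
fields at time t tested against χ by at most C|α|(N+1)^(-7/3) — i.e. O(|α|ε_N/(N+1)) per delivered
kick: a dipole of conserved quantities with arm ≤ 2ε_N (then ≍ a mean free path ≍ N^(-1/3))
propagated by linearised hydrodynamics acting on the smooth test function, instead of O(|α|/(N+1))
for two freely streaming particles (ideal gas) or the fluctuation level (N+1)^(-3/2) (trivial
bound). [difficulty: open-problem] -/
@[route_item "route-AtomisticToContinuum-LoadedDice"]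
def OneKickFootprint : Prop :=
  open Literature.MathematicalPhysics.KineticTheory Literature.Analysis.FluidPDE in ∀ (a₀ θ₀ : T3 → ℝ) (u₀ : T3 → V3), Continuous a₀ → Continuous θ₀ → Continuous u₀ → (∀ x, 0 < a₀ x) → (∀ x, 0 < θ₀ x) → ∃ σ₀ : ℝ, 0 < σ₀ ∧ ∀ σ : ℝ, 0 < σ → σ < σ₀ → ∀ (T : ℝ) (ρ θ : ℝ → T3 → ℝ) (u : ℝ → T3 → V3), IsHardSphereEulerSolution σ T ρ u θ → ∀ Φ : (N : ℕ) → HardSphereFlow (Torus.geometry (Fin 3)) (hsDiameter σ N) (N + 1), TendstoHydroFieldsAt (fun N => localGibbsLaw σ a₀ u₀ θ₀ N (Φ N)) Φ ρ u θ 0 → ∀ T' : ℝ, T' < T → ∀ (χ : T3 → ℝ) (K : NNReal), LipschitzWith K χ → let kick : (N : ℕ) → ℝ → Config (N + 1) (Fin 3) T3 → Config (N + 1) (Fin 3) T3 := fun N α z => let w : V3 := (Torus.geometry (Fin 3)).sepVec (z 1).1 (z 0).1; let g : V3 := (z 1).2 - (z 0).2; let c : V3 := (2 : ℝ)⁻¹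 • ((z 0).2 + (z 1).2); let e : V3 := w - (⟪w, g⟫_ℝ / ‖g‖ ^ 2) • g; let g' : V3 := Real.cos α • g + (Real.sin α * ‖g‖ * ‖e‖⁻¹) • e; if ‖w‖ < 2 * hsDiameter σ N ∧ e ≠ 0 then Function.update (Function.update z 0 ((z 0).1, c - (2 : ℝ)⁻¹ • g')) 1 ((z 1).1, c + (2 : ℝ)⁻¹ • g') else z; ∃ C : ℝ, ∃ N₀ : ℕ, ∀ N : ℕ, N₀ ≤ N → ∀ α : ℝ, |α| ≤ 1 → ∀ t ∈ Icc 0 T', |(∫ z, empiricalDensityField ((Φ N).flow t (kick N α z)) χ ∂(localGibbsLaw σ a₀ u₀ θ₀ N (Φ N))) - ∫ z, empiricalDensityField ((Φ N).flow t z) χ ∂(localGibbsLaw σ a₀ u₀ θ₀ N (Φ N))| ≤ C * |α| * ((N + 1 : ℕ) : ℝ) ^ (-(7 / 3 : ℝ)) ∧ ‖(∫ z, empiricalMomentumField ((Φ N).flow t (kick N α z)) χ ∂(localGibbsLaw σ a₀ u₀ θ₀ N (Φ N))) - ∫ z, empiricalMomentumField ((Φ N).flow t z) χ ∂(localGibbsLaw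 σ a₀ u₀ θ₀ N (Φ N))‖ ≤ C * |α| * ((N + 1 : ℕ) : ℝ) ^ (-(7 / 3 : ℝ)) ∧ |(∫ z, empiricalEnergyField ((Φ N).flow t (kick N α z)) χ ∂(localGibbsLaw σ a₀ u₀ θ₀ N (Φ N))) - ∫ z, empiricalEnergyField ((Φ N).flow t z) χ ∂(localGibbsLaw σ a₀ u₀ θ₀ N (Φ N))| ≤ C * |α| * ((N + 1 : ℕ) : ℝ) ^ (-(7 / 3 : ℝ))

-- item stmt-AtomisticToContinuum-7838 · crux · rank 4 · closed · moot by None · by planner — informal only, no Lean statement yet: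
--   [crux] THE LOADED RUNG X_R (card rungs (A)/(B)): for every ξ ∈ (0,1/2), ι > 0 and all continuous
--   profiles a₀, θ₀ > 0, u₀ there is σ₀ > 0 such that for 0 < σ < σ₀, every classical solution (ρ,u,θ)
--   on [0,T) of the LOADED Euler system IsLoadedEulerSolution σ T ρ u θ (definition request D2:
--   IsHardSphereEulerSolution with totalEnergyDensity replaced by ρ(‖u‖²/2 + 5θ/2) — two active
--   rotational degrees of freedom, L·a being conserved per particle; p = hsPressure σ ρ θ unchanged) and
--   every family of loaded flows Ψ_N : LoadedSphereFlow (Torus.geometry (Fin 3)) (hsDiameter σ N) ξ ι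
--   (N+1) (D1): if under

-- item stmt-AtomisticToContinuum-7852 · crux · rank 5 · closed · moot by None · by planner — informal only, no Lean statement yet:
--   [crux] THE TWO-TEMPERATURE RUNG (card regime (R2); what LoadedTransfer consumes): along the
--   eccentricity sequence ξ_N = κ(N+1)^(-1/6), for every κ ∈ (0, κ₀] and UNIFORMLY in κ, the conclusion
--   of LoadedEulerRung holds with the TWO-TEMPERATURE loaded Euler system as macroscopic target —
--   IsTwoTemperatureEulerSolution σ κ c T ρ u θtr θrot of definition request D2: mass; momentum with p =
--   hsPressure σ ρ θtr; translational energy ρ(‖u‖²/2 + 3θtr/2) with flux (E_tr + p)u and source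
--   −κ²·c(ρ,θtr,θrot)·ρ(θtr − θrot); active rotational energy ρθrot advected, ∂ₜ(ρθrot) + div(ρθrot u) =
--   +κ²cρ(θtr − θrot);

/-- item stmt-AtomisticToContinuum-4604 · crux · rank 6 · closed · moot by None · by planner
why it might fail: Transient dense clusters (rattlers) along the non-equilibrium evolution could make the collision intensity history-dependent and exceed any Enskog-type product bound at fixed σ; nothing beyond equilibrium is known at positive density.
sources: GST2013, Spohn1991, BodineauGallagherSaintRaymondSimonella2023, Alexander1975
[crux] GAIN / RATTLERS = (R): for all profiles ∃σ₀ ∀σ<σ₀ ∀T ∀flows ∃C<∞, N₀ such that for N ≥ N₀, 0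
≤ s ≤ t ≤ T and every continuous φ : V3×V3 → [0,∞]: E[Σ_{collisions in (s,t]} Σ_{ordered contact
pairs (i,j)} φ(vᵢ⁻, vⱼ⁻)] ≤ C·(ν_N/(N+1))·∫_s^t E⊗E[Σᵢ Σⱼ φ(vᵢ(τ,z), vⱼ(τ,z′))·|vᵢ(τ,z) − vⱼ(τ,z′)|]
dτ (two independent copies z, z′ of the initial law): the time-integrated incoming contact intensity
of f_τ^{(2)} is dominated by C × the Boltzmann–Enskog intensity ν_N|v−w|F_τ⊗F_τ of the mean
one-particle velocity law. With φ ≡ 1 it bounds the mean collision count by C×Enskog, with φ =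
ε|v−w| the mean collisional impulse (MeanCollisionalImpulseBound), with φ = mixed binomial monomials
the gain term of the Povzner hierarchy. [difficulty: open-problem] -/
@[route_item "route-AtomisticToContinuum-LoadedDice"]
def ContactIntensityDomination : Prop :=
  ∀ (a₀ θ₀ : Literature.MathematicalPhysics.KineticTheory.T3 → ℝ) (u₀ : Literature.MathematicalPhysics.KineticTheory.T3 → Literature.MathematicalPhysics.KineticTheory.V3), Continuous a₀ → Continuous θ₀ → Continuous u₀ → (∀ x, 0 < a₀ x) → (∀ x, 0 < θ₀ x) → ∃ σ₀ : ℝ, 0 < σ₀ ∧ ∀ σ : ℝ, 0 < σ → σ < σ₀ → ∀ T : ℝ, 0 < T → ∀ Φ : ((N : ℕ) → Literature.Analysis.FluidPDE.HardSphereFlow (Literature.Analysis.FluidPDE.Torus.geometry (Fin 3)) (Literature.MathematicalPhysics.KineticTheory.hsDiameter σ N) (N + 1)), ∃ C : ENNReal, C < ⊤ ∧ ∃ N₀ : ℕ, ∀ N : ℕ, N₀ ≤ N → ∀ s t : ℝ, 0 ≤ s → s ≤ t → t ≤ T → ∀ φ : Literature.MathematicalPhysics.KineticTheory.V3 × Literature.MathematicalPhysics.KineticTheory.V3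 → ENNReal, Continuous φ → (∫⁻ z, (∑ᶠ τ ∈ Literature.Analysis.FluidPDE.collisionTimes (Literature.Analysis.FluidPDE.Torus.geometry (Fin 3)) (Literature.MathematicalPhysics.KineticTheory.hsDiameter σ N) (fun r => (Φ N).flow r z) ∩ Set.Ioc s t, ∑ i : Fin (N + 1), ∑ j : Fin (N + 1), if i = j then (0 : ENNReal) else (Literature.Analysis.FluidPDE.contactSet (Literature.Analysis.FluidPDE.Torus.geometry (Fin 3)) (N + 1) (Literature.MathematicalPhysics.KineticTheory.hsDiameter σ N) i j).indicator (fun y => φ ((((Literature.Analysis.FluidPDE.collidePair (Literature.Analysis.FluidPDE.Torus.geometry (Fin 3)) i j y)) i).2, (((Literature.Analysis.FluidPDE.collidePair (Literature.Analysis.FluidPDE.Torus.geometry (Fin 3)) i j y)) j).2)) ((Φ N).flow τ z)) ∂(Literature.MathematicalPhysics.KineticTheory.localGibbsLaw σ a₀ u₀ θ₀ N (Φ N))) ≤ C * ENNReal.ofReal ((σ ^ 2 * ((N + 1 : ℕ) : ℝ) ^ ((1 : ℝ) / 3)) / ((N + 1 : ℕ) : ℝ)) * ∫⁻ τ in Set.Ioc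 s t, (∫⁻ z, ∫⁻ z', (∑ i : Fin (N + 1), ∑ j : Fin (N + 1), φ (((((Φ N).flow τ z)) i).2, ((((Φ N).flow τ z')) j).2) * ENNReal.ofReal ‖((((Φ N).flow τ z)) i).2 - ((((Φ N).flow τ z')) j).2‖) ∂(Literature.MathematicalPhysics.KineticTheory.localGibbsLaw σ a₀ u₀ θ₀ N (Φ N)) ∂(Literature.MathematicalPhysics.KineticTheory.localGibbsLaw σ a₀ u₀ θ₀ N (Φ N)))

/-- item stmt-AtomisticToContinuum-7659 · support · rank 9 · closed · moot by None · by planner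
sources: Spohn1991, BodineauGallagherSaintRaymondSimonella2023, doi:10.4007/annals.2023.198.3.3
[support] GLOBAL-EQUILIBRIUM special case of OneKickFootprint (profiles a₀ ≡ 1, u₀ ≡ 0, θ₀ ≡ θe; any
horizon T; same kick, fields and bound C|α|(N+1)^(-7/3)): a Green–Kubo-type statement — mean field
response at time t to a conserved dipole planted at time 0 under the invariant Gibbs law — the
cheapest place to prove or refute the footprint (equilibrium time-correlation technology). [deps:
OneKickFootprint] [difficulty: XL] -/
@[route_item "route-AtomisticToContinuum-LoadedDice"]
def EquilibriumKickResponse : Prop :=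
  open Literature.MathematicalPhysics.KineticTheory Literature.Analysis.FluidPDE in ∀ θe : ℝ, 0 < θe → ∃ σ₀ : ℝ, 0 < σ₀ ∧ ∀ σ : ℝ, 0 < σ → σ < σ₀ → ∀ T : ℝ, 0 < T → ∀ Φ : (N : ℕ) → HardSphereFlow (Torus.geometry (Fin 3)) (hsDiameter σ N) (N + 1), ∀ (χ : T3 → ℝ) (K : NNReal), LipschitzWith K χ → let kick : (N : ℕ) → ℝ → Config (N + 1) (Fin 3) T3 → Config (N + 1) (Fin 3) T3 := fun N α z => let w : V3 := (Torus.geometry (Fin 3)).sepVec (z 1).1 (z 0).1; let g : V3 := (z 1).2 - (z 0).2; let c : V3 := (2 : ℝ)⁻¹ • ((z 0).2 + (z 1).2); let e : V3 := w - (⟪w, g⟫_ℝ / ‖g‖ ^ 2) • g; let g' : V3 := Real.cos α • g + (Real.sin α * ‖g‖ * ‖e‖⁻¹) • e; if ‖w‖ < 2 * hsDiameter σ N ∧ e ≠ 0 then Function.update (Function.update z 0 ((z 0).1, c - (2 : ℝ)⁻¹ • g')) 1 ((z 1).1, c + (2 : ℝ)⁻¹ • g') else z; ∃ C : ℝ,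 ∃ N₀ : ℕ, ∀ N : ℕ, N₀ ≤ N → ∀ α : ℝ, |α| ≤ 1 → ∀ t ∈ Icc 0 T, |(∫ z, empiricalDensityField ((Φ N).flow t (kick N α z)) χ ∂(localGibbsLaw σ (fun _ => 1) (fun _ => 0) (fun _ => θe) N (Φ N))) - ∫ z, empiricalDensityField ((Φ N).flow t z) χ ∂(localGibbsLaw σ (fun _ => 1) (fun _ => 0) (fun _ => θe) N (Φ N))| ≤ C * |α| * ((N + 1 : ℕ) : ℝ) ^ (-(7 / 3 : ℝ)) ∧ ‖(∫ z, empiricalMomentumField ((Φ N).flow t (kick N α z)) χ ∂(localGibbsLaw σ (fun _ => 1) (fun _ => 0) (fun _ => θe) N (Φ N))) - ∫ z, empiricalMomentumField ((Φ N).flow t z) χ ∂(localGibbsLaw σ (fun _ => 1) (fun _ => 0) (fun _ => θe) N (Φ N))‖ ≤ C * |α| * ((N + 1 : ℕ) : ℝ) ^ (-(7 / 3 : ℝ)) ∧ |(∫ z, empiricalEnergyField ((Φ N).flow t (kick N α z)) χ ∂(localGibbsLaw σ (fun _ => 1) (fun _ => 0) (fun _ => θe) N (Φ N))) - ∫ z,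 empiricalEnergyField ((Φ N).flow t z) χ ∂(localGibbsLaw σ (fun _ => 1) (fun _ => 0) (fun _ => θe) N (Φ N))| ≤ C * |α| * ((N + 1 : ℕ) : ℝ) ^ (-(7 / 3 : ℝ))

/-- item stmt-AtomisticToContinuum-7660 · support · rank 9 · closed · moot by None · by planner
sources: Arnold1989, Kifer2009
[support] FEJÉR WRAPPING (card E3a, provable now): if a real random variable τ has a probability
density f with L¹-modulus ∫|f(x+h) − f(x)|dx ≤ L|h|, then for every frequency Ω > 0 and phase θ₀ the
law of θ₀ + Ωτ mod 1 is within L/(4Ω) of Haar on the circle, set by set: |P(θ₀ + Ωτ ∈ A) − |A|| ≤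
L/(4Ω) for every measurable A ⊂ ℝ/ℤ (average the wrapped density over one period). With f =
s⁻¹F(·/s) this is the card's C/(Ωs). [difficulty: provable-now] -/
@[route_item "route-AtomisticToContinuum-LoadedDice"]
def FejerWrapping : Prop :=
  ∀ (f : ℝ → ℝ), (∀ x, 0 ≤ f x) → Integrable f → ∫ x, f x = 1 → ∀ L : ℝ, 0 ≤ L → (∀ h : ℝ, ∫ x, |f (x + h) - f x| ≤ L * |h|) → ∀ Ω : ℝ, 0 < Ω → ∀ θ₀ : ℝ, ∀ A : Set UnitAddCircle, MeasurableSet A → |(∫ x in {x : ℝ | ((θ₀ + Ω * x : ℝ) : UnitAddCircle) ∈ A}, f x) - (volume A).toReal| ≤ L / (4 * Ω)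

/-- item stmt-AtomisticToContinuum-7661 · support · rank 9 · closed · moot by None · by planner
sources: doi:10.1063/1.1733511, ChapmanCowling1970, CoxFeres2016
[support] FAIR-DICE MECHANICS (card S1, provable now; fixes the collision law of D1): for diameter ε
> 0, eccentricity ξ ≥ 0, isotropic inertia ιε², unit masses, unit vectors a_i, a_j (mass centre →
geometric centre) and contact normal n (i → j), the two-body impact map Λ on (V_i,V_j,L_i,L_j) — g_n
= ⟨n,V_i − V_j⟩ + ξε(⟨n,ω_i×a_i⟩ − ⟨n,ω_j×a_j⟩), ω = L/(ιε²); J = 2g_n/(2 + (ξ²/ι)((1 − ⟨a_i,n⟩²) +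
(1 − ⟨a_j,n⟩²))); V_i ↦ V_i − Jn, V_j ↦ V_j + Jn, L_i ↦ L_i − Jξε(a_i×n), L_j ↦ L_j + Jξε(a_j×n) —
conserves V_i + V_j and |V_i|²/2 + |V_j|²/2 + (|L_i|² + |L_j|²)/(2ιε²), reverses g_n, and is an
involution (being linear, it then preserves Lebesgue measure: Liouville⊗Gaussian invariance and
detailed balance of K̄_ξ follow by Haar-averaging). [difficulty: provable-now] -/
@[route_item "route-AtomisticToContinuum-LoadedDice"]
def LoadedImpactInvolution : Prop :=
  open Literature.MathematicalPhysics.KineticTheory in let cr : V3 → V3 → V3 := fun x y => WithLp.toLp 2 (crossProduct (WithLp.ofLp x) (WithLp.ofLp y)); ∀ (ε ξ ι : ℝ), 0 < ε → 0 ≤ ξ → 0 < ι → ∀ (ai aj n : V3), ‖ai‖ = 1 → ‖aj‖ = 1 → ‖n‖ = 1 → let gn : V3 × V3 × V3 × V3 → ℝ := fun p => ⟪n, p.1 - p.2.1⟫_ℝ + ξ * ε * (⟪n, cr ((ι * ε ^ 2)⁻¹ • p.2.2.1) ai⟫_ℝ - ⟪n, cr ((ι * ε ^ 2)⁻¹ •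 p.2.2.2) aj⟫_ℝ); let J : V3 × V3 × V3 × V3 → ℝ := fun p => 2 * gn p / (2 + ξ ^ 2 / ι * ((1 - ⟪ai, n⟫_ℝ ^ 2) + (1 - ⟪aj, n⟫_ℝ ^ 2))); let Λ : V3 × V3 × V3 × V3 → V3 × V3 × V3 × V3 := fun p => (p.1 - J p • n, p.2.1 + J p • n, p.2.2.1 - (J p * ξ * ε) • cr ai n, p.2.2.2 + (J p * ξ * ε) • cr aj n); ∀ p : V3 × V3 × V3 × V3, (Λ p).1 + (Λ p).2.1 = p.1 + p.2.1 ∧ ‖(Λ p).1‖ ^ 2 / 2 + ‖(Λ p).2.1‖ ^ 2 / 2 + (‖(Λ p).2.2.1‖ ^ 2 + ‖(Λ p).2.2.2‖ ^ 2) / (2 * (ι * ε ^ 2)) = ‖p.1‖ ^ 2 / 2 + ‖p.2.1‖ ^ 2 / 2 + (‖p.2.2.1‖ ^ 2 + ‖p.2.2.2‖ ^ 2) / (2 * (ι * ε ^ 2)) ∧ gn (Λ p) = -gn p ∧ Λ (Λ p) = p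

/-- item stmt-AtomisticToContinuum-7662 · support · rank 9 · closed · moot by None · by planner
sources: OllaVaradhanYau1993, ChenLevermoreLiu1994, Spohn1991
[support] THE CONSUMER (typed shadow of the card's leg (C)): OneKickFootprint →
ContactIntensityDomination → HydrodynamicLimit. Intended proof = the loaded programme:
TwoTemperatureRung puts the translational fields of LS(σ, κ(N+1)^(-1/6), ι) within o_N(1) of the
two-temperature solution, TwoTemperaturePDE puts that within O(κ²) of the conjunct's Euler solution
on [0,T′], and a Lindeberg/Duhamel swap in ξ ∈ [0, κ(N+1)^(-1/6)] (d/dξ E_ξ[F(fields_t)] =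
Σ_contacts E[(∂_ξ outcome)·(footprint)], footprint bound assumed UNIFORM along the loaded family,
contact budget from ContactIntensityDomination) puts the true gas's field laws within
O(κ(N+1)^(-1/6)) + O(κ²) of the loaded ones; κ → 0 last. In substance as hard as the conjunct
(contains TwoTemperatureRung); filed so that the Assembly is pure logic and the two typed true-gas
inputs are refutable now. [deps: OneKickFootprint, ContactIntensityDomination] [difficulty:
open-problem] -/
@[route_item "route-AtomisticToContinuum-LoadedDice"]
def LoadedTransfer : Prop :=
  OneKickFootprint → ContactIntensityDomination → Literature.MathematicalPhysics.KineticTheory.HydrodynamicLimit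

-- item stmt-AtomisticToContinuum-7841 · support · rank 9 · closed · moot by None · by planner — informal only, no Lean statement yet:
--   [support] LOADED STATICS = HARD-SPHERE STATICS (card E1/S3; provable once D1 lands): under
--   loadedLocalGibbsLaw σ ξ ι a₀ u₀ θ₀ N (density ∝ 𝟙_domain ∏ a₀(X_k)
--   M_(1,u₀(X_k),θ₀(X_k))(V_k)·Gaussian(L_k; ιε²θ₀(X_k)) ⊗ Haar(a_k), activity evaluated at the
--   GEOMETRIC centre X_k) the law of k ↦ (X_k, V_k) is EXACTLY localGibbsLaw σ a₀ u₀ θ₀ N (the hard-core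
--   constraint is on geometric centres; (X,a) ↦ (X − ξεa, a) is a shear preserving volume ⊗ area, so
--   mass-centre and geometric-centre parametrisations carry the same product measure), the a_k are
--   independent Haar and the L_k independent Gaussians given

-- item stmt-AtomisticToContinuum-7847 · support · rank 9 · closed · moot by None · by planner — informal only, no Lean statement yet:
--   [support] TWO-TEMPERATURE PDE FACTS (card S4; typable now over
--   Literature.Analysis.FunctionSpaces.TorusCalculus once D2's two predicates are written — this item
--   inlines them if D2 has not landed): (a) STRUCTURE: the two-temperature loaded Euler system (mass;
--   momentum with hsPressure σ ρ θtr; translational energy with relaxation source −κ²cρ(θtr − θrot);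
--   rotational energy ρθrot advected with source +κ²cρ(θtr − θrot)) is symmetrisable hyperbolic with the
--   convex entropy η_σ = −ρ(3/2·log θtr + log θrot − log ρ − hsExcessFreeEnergy(ρσ³)) dissipated by the
--   source (sub-characteristic ordering: frozen

/-- item stmt-AtomisticToContinuum-7663 · assembly · rank 1 · closed · moot by None · by planner
sources: OllaVaradhanYau1993, Spohn1991
[assembly] OneKickFootprint → ContactIntensityDomination → LoadedTransfer → HydrodynamicLimit (modus
ponens). -/
@[route_item "route-AtomisticToContinuum-LoadedDice"]
def Assembly : Prop :=
  OneKickFootprint → ContactIntensityDomination → LoadedTransfer → Literature.MathematicalPhysics.KineticTheory.HydrodynamicLimit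

end Summit.AtomisticToContinuum.HydrodynamicLimit.Theses.LoadedDice
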